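import Summits.CriticalPhenomena.CardyFormulaZ2.Theorems.CardyIKTransportIKMixedBoxCrossingQuenchedDefs
import Summits.CriticalPhenomena.CardyFormulaZ2.Theorems.CardyIKTransportIKMixedBoxCrossingQuenchedGlueStep
import Summits.CriticalPhenomena.CardyFormulaZ2.Theorems.CardyIKTransportIKMixedBoxCrossingQuenchedBottomRow
import Summits.CriticalPhenomena.CardyFormulaZ2.Theorems.CardyIKTransportIKLinearTransportFarRSWAllAspects

/-!
# Stub `stub_squaresFromTall`
# (line `defect-closure-exploration` v7, crux `IKMixedBoxCrossing`, stmt-CriticalPhenomena-5911)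

Support file (`--supports stmt-CriticalPhenomena-5911`): the LADDER assembly
`SquaresFromTall : TallEasyTransverse → ApproxHarrisFam → IsotropyFloorAll` of skeleton v7
(`…IKMixedBoxCrossingQuenchedDefs`).

Proof.  From `TallEasyTransverse` get `K₀, δ₀` (`1 ≤ K₀`, since a box of height `0` is never crossed:
`pLR_height_zero`); from the landed all-aspect vertical clause (`verticalClause_aspect (2 K₀)`, p146877) get
`c_V`.  At scale `t ≥ 1` consider the `J + 1 = 4 K₀ + 1` boxes `B_j = [a + j t, a + j t + 2t) × [b, b + 2 K₀ t)`
(LR-crossed with probability `≥ δ₀`) and the `J` overlap strips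
`O_j = [a + (j+1) t, a + (j+1) t + t) × [b, b + 2 K₀ t)` (aspect `2 K₀`, BT-crossed with probability `≥ c_V`).
On the intersection of these `2J + 1` events the landed
planar glue step (`glueStep`, p163709), iterated `J` times (`ladder_mem`), produces a black LR crossing of the
`(J + 2) t × 2 K₀ t` box at `(a, b)` (`iInter_fam_subset`); `ApproxHarrisFam` for the family (`Fin.append` of the
LR boxes and the BT strips, every box at least `t × t`) at deficit `η = θ^{2J+1}/2`, `θ = min δ₀ c_V`, bounds its
probability below by `θ^{2J+1}/2` once `t ≥ n₀`.  For a square of side `N ≥ 2 K₀ (n₀ + 1)` take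
`t = N / (2 K₀)`: then `2 K₀ t ≤ N ≤ (J + 2) t`, so the wide crossing restricts to the `N × 2 K₀ t` box
(width antitonicity, `stub_monotone`, p90765) and lifts to the `N × N` box (height monotonicity,
`FarRSWFragments.lrCross_subset_of_height_le`).  Small sides `N < 2 K₀ (n₀ + 1)` are covered by the all-black
bottom row (`bottomRowFloor`, landed `…QuenchedBottomRow`: `pLR ≥ 2^{-N}`).
-/

noncomputable section

namespace Summit.CriticalPhenomena.CardyFormulaZ2.Cruxes.IKMixedBoxCrossing.QuenchedChainFKG

open scoped Classical BigOperators
open MeasureTheory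
open Literature.Probability.Percolation
open Summit.CriticalPhenomena.CardyFormulaZ2.Theorems.IKLinearTransport.PinnedDiagramExchange
  (Ω μIK Obs obs lrCross tbCross)
open Summit.CriticalPhenomena.CardyFormulaZ2.Theorems.IKLinearTransport.PinnedDiagramExchange.CouplingToLimits
  (isProbabilityMeasure_μIK)
open Summit.CriticalPhenomena.CardyFormulaZ2.Theorems.IKLinearTransport.PinnedDiagramExchange.FarRSWAllAspects
  (verticalClause_aspect)
open Summit.CriticalPhenomena.CardyFormulaZ2.Theorems.IKLinearTransport.PinnedDiagramExchange.FarRSWFragments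
  (lrCross_subset_of_height_le)
open Summit.CriticalPhenomena.CardyFormulaZ2.Cruxes.IKMixedBoxCrossing.PairedMirrorExploration
  (pLR pTB stub_monotone)

namespace Ladder

/-! ## §1 Two elementary facts -/

/-- A box of height `0` has no left column cell, so its LR crossing event is empty: `pLR S a b w 0 = 0`. -/
theorem pLR_height_zero (S : Set ℤ) (a b : ℤ) (w : ℕ) : pLR S a b w 0 = 0 := by
  have h : obs S ⁻¹' lrCross a b w 0 = ∅ := by
    ext ω
    simp only [Set.mem_preimage, lrCross, Set.mem_setOf_eq, mem_openCrossing_iff, Set.mem_empty_iff_false,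
      iff_false]
    rintro ⟨x, ⟨-, hb, hlt⟩, -⟩
    push_cast at hlt
    omega
  simp [pLR, h]

/-- In `TallEasyTransverse` the aspect constant is positive: `K₀ = 0` would bound `pLR S a b 1 0 = 0` below by
`δ > 0`. -/
theorem one_le_of_tall {K₀ : ℕ} {δ : ℝ} (hδ : 0 < δ)
    (h : ∀ S : Set ℤ, ∀ n : ℕ, ∀ a b : ℤ, 1 ≤ n → δ ≤ pLR S a b n (K₀ * n)) : 1 ≤ K₀ := by
  by_contra hK
  have hK0 : K₀ = 0 := by omega
  have h1 := h ∅ 1 0 0 le_rfl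
  rw [hK0, Nat.zero_mul, pLR_height_zero] at h1
  linarith

/-! ## §2 The ladder: iterated glue -/

/-- THE LADDER (deterministic): black LR crossings of the boxes `[a + j t, a + j t + 2t) × [b, b + H)`, `j ≤ m`,
and black BT crossings of the overlap strips `[a + (j+1) t, a + (j+1) t + t) × [b, b + H)`, `j < m`, glue (by `m`
applications of `glueStep`) to a black LR crossing of `[a, a + m t + 2 t) × [b, b + H)`. -/
theorem ladder_mem {x : Obs} {a b : ℤ} {t H : ℕ} (ht : 1 ≤ t) (m : ℕ)
    (hL : ∀ j ≤ m, x ∈ lrCross (a + ((j * t : ℕ) : ℤ)) b (2 * t) H)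
    (hB : ∀ j < m, x ∈ tbCross (a + (((j + 1) * t : ℕ) : ℤ)) b t H) :
    x ∈ lrCross a b (m * t + 2 * t) H := by
  induction m with
  | zero => simpa using hL 0 le_rfl
  | succ m ih =>
    have ih' := ih (fun j hj => hL j (by omega)) (fun j hj => hB j (by omega))
    have e1 : (m + 1) * t = m * t + t := by ring
    have e2 : m * t + 2 * t - (m + 1) * t = t := by rw [e1]; omega
    have key := glueStep x a b ((m + 1) * t) (m * t + 2 * t) (2 * t) H (by rw [e1]; omega) (by rw [e1]; omega)
      ih' (hL (m + 1) le_rfl)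
    rw [e2] at key
    exact key (hB m (lt_add_one m))

/-! ## §3 The family of box events of the ladder

The family is `Fin.append` of the `J + 1` LR boxes `[a + j t, a + j t + 2t) × [b, b + K₀ (2t))` and the `J` BT
overlap strips `[a + (j+1) t, a + (j+1) t + t) × [b, b + K₀ (2t))`; the lemmas below are stated for any family `bs`
with these values (hypotheses `hl`, `hr`), so that no definition is introduced. -/

/-- Every box of the ladder family is at least `t` wide and at least `t` tall (for `1 ≤ K₀`). -/
theorem fam_size {K₀ J t : ℕ} {a b : ℤ} (hK₀ : 1 ≤ K₀) {bs : Fin (J + 1 + J) → BoxSpec}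
    (hl : ∀ j : Fin (J + 1),
      bs (Fin.castAdd J j) = ⟨true, a + (((j : ℕ) * t : ℕ) : ℤ), b, 2 * t, K₀ * (2 * t)⟩)
    (hr : ∀ j : Fin J,
      bs (Fin.natAdd (J + 1) j) = ⟨false, a + ((((j : ℕ) + 1) * t : ℕ) : ℤ), b, t, K₀ * (2 * t)⟩)
    (i : Fin (J + 1 + J)) : t ≤ (bs i).w ∧ t ≤ (bs i).h := by
  have hH : t ≤ K₀ * (2 * t) := by
    have := Nat.mul_le_mul_right (2 * t) hK₀
    omega
  induction i using Fin.addCases with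
  | left j =>
    simp only [hl j]
    exact ⟨by omega, hH⟩
  | right j =>
    simp only [hr j]
    exact ⟨le_rfl, hH⟩

/-- Every box of the ladder family is crossed with probability at least `min δ₀ c_V`: the LR boxes by
`TallEasyTransverse` at `n = 2t`, the overlap strips (aspect `2 K₀`) by the all-aspect vertical clause. -/
theorem fam_prob {K₀ J t : ℕ} {a b : ℤ} {δ₀ cV : ℝ} (hK₀ : 1 ≤ K₀) (ht : 1 ≤ t)
    (hT : ∀ S : Set ℤ, ∀ n : ℕ, ∀ a b : ℤ, 1 ≤ n → δ₀ ≤ pLR S a b n (K₀ * n))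
    (hV : ∀ (S : Set ℤ) (a b : ℤ) (w h : ℕ), 1 ≤ w → 1 ≤ h → h ≤ 2 * K₀ * w →
      cV ≤ pTB S a b w h)
    {bs : Fin (J + 1 + J) → BoxSpec}
    (hl : ∀ j : Fin (J + 1),
      bs (Fin.castAdd J j) = ⟨true, a + (((j : ℕ) * t : ℕ) : ℤ), b, 2 * t, K₀ * (2 * t)⟩)
    (hr : ∀ j : Fin J,
      bs (Fin.natAdd (J + 1) j) = ⟨false, a + ((((j : ℕ) + 1) * t : ℕ) : ℤ), b, t, K₀ * (2 * t)⟩)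
    (S : Set ℤ) (i : Fin (J + 1 + J)) : min δ₀ cV ≤ boxProb S (bs i) := by
  induction i using Fin.addCases with
  | left j =>
    rw [hl j, boxProb_lr]
    exact (min_le_left _ _).trans (hT S (2 * t) _ b (by omega))
  | right j =>
    rw [hr j, boxProb_tb]
    have h1 : 1 ≤ K₀ * (2 * t) := Nat.mul_pos (by omega) (by omega)
    exact (min_le_right _ _).trans (hV S _ b t (K₀ * (2 * t)) ht h1 (le_of_eq (by ring)))

/-- On the intersection of the ladder events there is a black LR crossing of the `(J t + 2 t) × K₀ (2t)` box at
`(a, b)` (`ladder_mem`). -/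
theorem iInter_fam_subset {K₀ J t : ℕ} {a b : ℤ} (ht : 1 ≤ t) {bs : Fin (J + 1 + J) → BoxSpec}
    (hl : ∀ j : Fin (J + 1),
      bs (Fin.castAdd J j) = ⟨true, a + (((j : ℕ) * t : ℕ) : ℤ), b, 2 * t, K₀ * (2 * t)⟩)
    (hr : ∀ j : Fin J,
      bs (Fin.natAdd (J + 1) j) = ⟨false, a + ((((j : ℕ) + 1) * t : ℕ) : ℤ), b, t, K₀ * (2 * t)⟩)
    (S : Set ℤ) : (⋂ i, boxEvent S (bs i)) ⊆ obs S ⁻¹' lrCross a b (J * t + 2 * t) (K₀ * (2 * t)) := by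
  intro ω hω
  rw [Set.mem_iInter] at hω
  refine ladder_mem ht J (fun j hj => ?_) (fun j hj => ?_)
  · have h := hω (Fin.castAdd J ⟨j, Nat.lt_succ_of_le hj⟩)
    rw [hl] at h
    exact h
  · have h := hω (Fin.natAdd (J + 1) ⟨j, hj⟩)
    rw [hr] at h
    exact h

end Ladder

open Ladder in
/-- **SQUARES FROM TALL-EASY** (registered stub `stub_squaresFromTall` of line `defect-closure-exploration` v7 —
the LADDER): `TallEasyTransverse` (`K₀, δ₀`), the landed all-aspect vertical clause (`c_V` at aspect `2 K₀`) and
`ApproxHarrisFam` for the `8 K₀ + 1` ladder events give black LR crossings of boxes wider than tall with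
probability `≥ (min δ₀ c_V)^{8 K₀ + 1} / 2` at every scale `t ≥ n₀ + 1`, hence of every square of side
`N ≥ 2 K₀ (n₀ + 1)` (width antitonicity + height monotonicity); smaller squares by the all-black bottom row. -/
theorem stub_squaresFromTall : SquaresFromTall := by
  intro hT hF
  obtain ⟨K₀, δ₀, hδ₀, hT⟩ := hT
  have hK₀ : 1 ≤ K₀ := one_le_of_tall hδ₀ hT
  obtain ⟨cV, hcV, hV⟩ := verticalClause_aspect (2 * K₀)
  haveI := isProbabilityMeasure_μIK
  -- the number of glue steps and the common one-box floor
  set J : ℕ := 4 * K₀ with hJ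
  set θ : ℝ := min δ₀ cV with hθ
  have hθ0 : 0 < θ := lt_min hδ₀ hcV
  obtain ⟨n₀, hn₀⟩ := hF (J + 1 + J) (θ ^ (J + 1 + J) / 2) (by positivity)
  refine ⟨min (θ ^ (J + 1 + J) / 2) ((1 / 2 : ℝ) ^ (2 * K₀ * (n₀ + 1))),
    lt_min (by positivity) (by positivity), ?_⟩
  intro S N hN a b
  rcases Nat.lt_or_ge N (2 * K₀ * (n₀ + 1)) with hsmall | hbig
  · -- small sides: the all-black bottom row
    calc min (θ ^ (J + 1 + J) / 2) ((1 / 2 : ℝ) ^ (2 * K₀ * (n₀ + 1)))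
          ≤ (1 / 2 : ℝ) ^ (2 * K₀ * (n₀ + 1)) := min_le_right _ _
      _ ≤ (1 / 2 : ℝ) ^ N := pow_le_pow_of_le_one (by norm_num) (by norm_num) hsmall.le
      _ ≤ pLR S a b N N := bottomRowFloor S a b N N hN hN
  · -- large sides: the ladder at scale `t = N / (2 K₀)`
    set t : ℕ := N / (2 * K₀) with ht_def
    have h2K : 0 < 2 * K₀ := by omega
    have ht : n₀ + 1 ≤ t := (Nat.le_div_iff_mul_le h2K).2 (by rw [Nat.mul_comm]; exact hbig)
    have ht1 : 1 ≤ t := by omega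
    have hHN : K₀ * (2 * t) ≤ N := by
      have h := Nat.div_mul_le_self N (2 * K₀)
      have e : N / (2 * K₀) * (2 * K₀) = K₀ * (2 * t) := by rw [ht_def]; ring
      omega
    have hNW : N ≤ J * t + 2 * t := by
      have h1 : N < 2 * K₀ * (t + 1) := Nat.lt_mul_div_succ N h2K
      have h2 : K₀ ≤ K₀ * t := Nat.le_mul_of_pos_right K₀ ht1
      have e : J * t + 2 * t = 4 * (K₀ * t) + 2 * t := by rw [hJ]; ring
      have e' : 2 * K₀ * (t + 1) = 2 * (K₀ * t) + 2 * K₀ := by ring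
      omega
    -- the ladder family: `J + 1` LR boxes and `J` BT overlap strips
    obtain ⟨bs, hl, hr⟩ : ∃ bs : Fin (J + 1 + J) → BoxSpec,
        (∀ j : Fin (J + 1),
          bs (Fin.castAdd J j) = ⟨true, a + (((j : ℕ) * t : ℕ) : ℤ), b, 2 * t, K₀ * (2 * t)⟩) ∧
        (∀ j : Fin J,
          bs (Fin.natAdd (J + 1) j) = ⟨false, a + ((((j : ℕ) + 1) * t : ℕ) : ℤ), b, t, K₀ * (2 * t)⟩) :=
      ⟨Fin.append
          (fun j : Fin (J + 1) => (⟨true, a + (((j : ℕ) * t : ℕ) : ℤ), b, 2 * t, K₀ * (2 * t)⟩ : BoxSpec))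
          (fun j : Fin J => ⟨false, a + ((((j : ℕ) + 1) * t : ℕ) : ℤ), b, t, K₀ * (2 * t)⟩),
        fun j => Fin.append_left _ _ j, fun j => Fin.append_right _ _ j⟩
    -- approximate Harris for the ladder family at scale `t ≥ n₀`
    have hfam := hn₀ S t (by omega) bs (fam_size hK₀ hl hr)
    have hprod : θ ^ (J + 1 + J) ≤ ∏ i, boxProb S (bs i) := by
      calc θ ^ (J + 1 + J) = ∏ _i : Fin (J + 1 + J), θ := (Fin.prod_const _ _).symm
        _ ≤ ∏ i, boxProb S (bs i) :=
          Finset.prod_le_prod (fun i _ => hθ0.le) (fun i _ => fam_prob hK₀ ht1 hT hV hl hr S i)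
    -- the glued crossing restricts to the square
    have hglue : μIK.real (⋂ i, boxEvent S (bs i)) ≤ pLR S a b N N := by
      calc μIK.real (⋂ i, boxEvent S (bs i))
            ≤ pLR S a b (J * t + 2 * t) (K₀ * (2 * t)) := measureReal_mono (iInter_fam_subset ht1 hl hr S)
        _ ≤ pLR S a b N (K₀ * (2 * t)) := stub_monotone.1 S a b N (J * t + 2 * t) (K₀ * (2 * t)) hN hNW
        _ ≤ pLR S a b N N := measureReal_mono (Set.preimage_mono (lrCross_subset_of_height_le hHN))
    calc min (θ ^ (J + 1 + J) / 2) ((1 / 2 : ℝ) ^ (2 * K₀ * (n₀ + 1)))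
          ≤ θ ^ (J + 1 + J) / 2 := min_le_left _ _
      _ ≤ (∏ i, boxProb S (bs i)) - θ ^ (J + 1 + J) / 2 := by linarith
      _ ≤ μIK.real (⋂ i, boxEvent S (bs i)) := hfam
      _ ≤ pLR S a b N N := hglue

end Summit.CriticalPhenomena.CardyFormulaZ2.Cruxes.IKMixedBoxCrossing.QuenchedChainFKG

end
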